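import Mathlib
import HarnessLib
import Literature.MathematicalPhysics.StatisticalMechanics.TorusFRDGradCovSecondDiff
import Literature.MathematicalPhysics.StatisticalMechanics.ParallelogramSecondDiff
import Literature.MathematicalPhysics.StatisticalMechanics.TuningLipschitzTorusFRD
import Literature.MathematicalPhysics.StatisticalMechanics.StepOperatorALipschitz

/-!
# Parallelogram second differences of `A_k⁻¹` in the tuning parameter, torus data (the q-slot F4a2):
# `‖Σ± (A^{(q••)}_k)⁻¹ w‖ ≤ (d⁴·secondDiffConst(C_{·,2})/h²) · Σ|y| · Σ|z| · ‖w‖` ([ABKM19] Lemma 12.6, `C^{1,1}` form)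

`A_k⁻¹ = stepOpAInv γ` is AFFINE in the quadratic shift `γ = γ(𝒞_{1+q,k+1})` (only the constant coefficient
moves, linearly), so a parallelogram second difference of `q ↦ (A^{(q)}_k)⁻¹ w` is
`stepOpAInv (Σ±γ) w − stepOpAInv 0 w`, controlled by `hamNorm_stepOpAInv_sub_abkm_le` once
`L^{dk}·|Σ± γ_p| ≲ Σ|y|·Σ|z|`.  The latter follows from the LINE second differences of `γ_p`
(`TorusFRDGradCovSecondDiff`, clause (iv) with `ℓ = 2`) by the elementary bilinear lemma
`ParallelogramSecondDiff.norm_secondDiff_le_bilinear` on the sup-normed space `Fin d → Fin d → ℝ`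
(`Σ|h| ≤ d²‖h‖_∞`):

* `stepOpAInv_secondDiff_eq` — affinity: `Σ± stepOpAInv γ•• H = stepOpAInv (Σ±γ) H − stepOpAInv 0 H`;
* `entrySum_le_sq_mul_norm`, `convex_symmBall` — bookkeeping on `Fin d → Fin d → ℝ`;
* **`abs_gradCov_secondDiff_le_of_torusFRD`** — `L^{(k−1)d}·|Σ± γ_p(𝒞_{1+q••,k})| ≤ 4 d⁴ secondDiffConst(C_{·,2}) · Σ|y| · Σ|z|`
  for four symmetric corners in the ball `Σ|·| ≤ T₀ ≤ ½`;
* **`norm_rgA_symm_secondDiff_le_of_torusFRD`** — the family (F4a2):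
  `‖Σ± (rgA L h 𝒞s_{q••} k)⁻¹ w‖ ≤ (d⁴ secondDiffConst(C_{·,2}) / h²) · Σ|y| · Σ|z| · ‖w‖`, N-free.

Everything is proved; no named fact.

## References
* S. Adams, S. Buchholz, R. Kotecký, S. Müller, arXiv:1910.13564, Lemma 10.5, Lemma 12.6 (12.51), Theorem 6.1 (iv)
  [AdamsBuchholzKoteckyMuller2019].
-/

noncomputable section

namespace Literature.MathematicalPhysics.StatisticalMechanics.GradientRG

open Real Set Finset
open Literature.MathematicalPhysics.StatisticalMechanics.GradientFRD
  (fourierCoeff IsElliptic IsUnitSymm iterDiff)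

variable {d M : ℕ} [NeZero M]

/-! ## Affinity of `A⁻¹` in `γ` -/

omit [NeZero M] in
/-- **`A(γ)⁻¹` is affine in `γ`**: `Σ± stepOpAInv γ_{ij} H = stepOpAInv (Σ± γ_{ij}) H − stepOpAInv 0 H`.
[cite: AdamsBuchholzKoteckyMuller2019, Lemma 10.5] -/
theorem stepOpAInv_secondDiff_eq {𝕜 : Type*} [NormedField 𝕜] [NormedAlgebra ℝ 𝕜] (γ₁₁ γ₁₀ γ₀₁ γ₀₀ : quadIndex d → ℝ)
    (H : RelevantHamiltonian 𝕜 d) :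
    stepOpAInv γ₁₁ H - stepOpAInv γ₁₀ H - stepOpAInv γ₀₁ H + stepOpAInv γ₀₀ H =
      stepOpAInv (γ₁₁ - γ₁₀ - γ₀₁ + γ₀₀) H - stepOpAInv 0 H := by
  funext ι
  rcases ι with u | α | q
  · simp only [Pi.add_apply, Pi.sub_apply, stepOpAInv_const, Pi.zero_apply, zero_smul, Finset.sum_const_zero,
      sub_zero, sub_smul, add_smul, Finset.sum_add_distrib, Finset.sum_sub_distrib]
    abel
  · simp only [Pi.add_apply, Pi.sub_apply, stepOpAInv_lin]; abel
  · simp only [Pi.add_apply, Pi.sub_apply, stepOpAInv_quad]; abel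

/-! ## Bookkeeping on `Fin d → Fin d → ℝ` with the sup norm -/

omit [NeZero M] in
/-- `Σ|h i j| ≤ d² ‖h‖_∞`. [cite: AdamsBuchholzKoteckyMuller2019, Lemma 12.6] -/
theorem entrySum_le_sq_mul_norm (h : Fin d → Fin d → ℝ) : ∑ i, ∑ j, |h i j| ≤ (d : ℝ) ^ 2 * ‖h‖ := by
  have h1 : ∀ i j, |h i j| ≤ ‖h‖ := fun i j =>
    (Real.norm_eq_abs _ ▸ norm_le_pi_norm (h i) j).trans (norm_le_pi_norm h i)
  calc ∑ i, ∑ j, |h i j| ≤ ∑ _i : Fin d, ∑ _j : Fin d, ‖h‖ := sum_le_sum fun i _ => sum_le_sum fun j _ => h1 i j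
    _ = (d : ℝ) ^ 2 * ‖h‖ := by simp [Finset.sum_const, Finset.card_univ, Fintype.card_fin]; ring

omit [NeZero M] in
/-- `‖h‖_∞ ≤ Σ|h i j|`. [cite: AdamsBuchholzKoteckyMuller2019, Lemma 12.6] -/
theorem norm_le_entrySum (h : Fin d → Fin d → ℝ) : ‖h‖ ≤ ∑ i, ∑ j, |h i j| := by
  refine (pi_norm_le_iff_of_nonneg (sum_nonneg fun _ _ => sum_nonneg fun _ _ => abs_nonneg _)).2 fun i => ?_
  refine (pi_norm_le_iff_of_nonneg (sum_nonneg fun _ _ => sum_nonneg fun _ _ => abs_nonneg _)).2 fun j => ?_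
  rw [Real.norm_eq_abs]
  exact (single_le_sum (f := fun j => |h i j|) (fun _ _ => abs_nonneg _) (mem_univ j)).trans
    (single_le_sum (f := fun i => ∑ j, |h i j|) (fun _ _ => sum_nonneg fun _ _ => abs_nonneg _) (mem_univ i))

omit [NeZero M] in
/-- The ball `{q symmetric, Σ|q| ≤ T₀}` is convex. [cite: AdamsBuchholzKoteckyMuller2019, Lemma 12.6] -/
theorem convex_symmBall (T₀ : ℝ) :
    Convex ℝ {q : Fin d → Fin d → ℝ | (Matrix.of q).IsSymm ∧ ∑ i, ∑ j, |q i j| ≤ T₀} := by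
  intro x hx y hy a b ha hb hab
  refine ⟨?_, ?_⟩
  · have h1 : Matrix.of (a • x + b • y) = a • Matrix.of x + b • Matrix.of y := rfl
    rw [h1]
    exact (hx.1.smul a).add (hy.1.smul b)
  · calc ∑ i, ∑ j, |(a • x + b • y) i j| ≤ ∑ i, ∑ j, (a * |x i j| + b * |y i j|) := by
          refine sum_le_sum fun i _ => sum_le_sum fun j _ => ?_
          simp only [Pi.add_apply, Pi.smul_apply, smul_eq_mul]
          calc |a * x i j + b * y i j| ≤ |a * x i j| + |b * y i j| := abs_add_le _ _
            _ = a * |x i j| + b * |y i j| := by rw [abs_mul, abs_mul, abs_of_nonneg ha, abs_of_nonneg hb]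
      _ = a * ∑ i, ∑ j, |x i j| + b * ∑ i, ∑ j, |y i j| := by
          simp only [sum_add_distrib, ← mul_sum]
      _ ≤ a * T₀ + b * T₀ := add_le_add (mul_le_mul_of_nonneg_left hx.2 ha) (mul_le_mul_of_nonneg_left hy.2 hb)
      _ = T₀ := by rw [← add_mul, hab, one_mul]

/-! ## Parallelogram second differences of `γ_p` in the tuning parameter -/

/-- **`L^{(k−1)d}·|Σ± γ_p(𝒞_{1+q••,k})| ≤ 4 d⁴ secondDiffConst(C_{·,2}) · Σ|y| · Σ|z|`** for symmetric
`q, q+y, q+z, q+y+z` in the ball `Σ|·| ≤ T₀ ≤ ½` (clause (iv), `ℓ = 2`, along lines + the bilinear lemma).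
[cite: AdamsBuchholzKoteckyMuller2019, Lemma 12.6 / Theorem 6.1 (iv)] -/
theorem abs_gradCov_secondDiff_le_of_torusFRD
    {𝒞 : Matrix (Fin d) (Fin d) ℝ → ℕ → (Fin d → ZMod M) → ℝ} {Cα : (Fin d → ℕ) → ℕ → ℝ} {L N n : ℕ}
    (hiv : ∀ A : Matrix (Fin d) (Fin d) ℝ, IsElliptic (1 / 2 : ℝ) 2 A →
      ∀ k, 1 ≤ k → k ≤ N + 1 → ∀ B : Matrix (Fin d) (Fin d) ℝ, IsUnitSymm B →
        (∃ ε : ℝ, 0 < ε ∧ ∀ x : Fin d → ZMod M,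
          ContDiffOn ℝ ⊤ (fun s : ℝ => 𝒞 (A + s • B) k x) (Set.Ioo (-ε) ε)) ∧
        ∀ α : Fin d → ℕ, ∑ i, α i ≤ n → ∀ ℓ : ℕ, ∀ x : Fin d → ZMod M,
          abs (iteratedDeriv ℓ (fun s : ℝ => iterDiff α (𝒞 (A + s • B) k) x) 0)
            ≤ Cα α ℓ / (L : ℝ) ^ ((k - 1) * (d - 2 + ∑ i, α i)))
    (hd : 2 ≤ d) (hn : 2 ≤ n) (hL : 1 ≤ L) {T₀ : ℝ} (hT₀ : T₀ ≤ 1 / 2)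
    {k : ℕ} (hk1 : 1 ≤ k) (hkN : k ≤ N + 1) (p : quadIndex d)
    {q y z : Matrix (Fin d) (Fin d) ℝ}
    (hq : q.IsSymm ∧ ∑ i, ∑ j, |q i j| ≤ T₀) (hqy : (q + y).IsSymm ∧ ∑ i, ∑ j, |(q + y) i j| ≤ T₀)
    (hqz : (q + z).IsSymm ∧ ∑ i, ∑ j, |(q + z) i j| ≤ T₀)
    (hqyz : (q + y + z).IsSymm ∧ ∑ i, ∑ j, |(q + y + z) i j| ≤ T₀) :
    (L : ℝ) ^ ((k - 1) * d) *
        |gradCov (𝒞 ((1 : Matrix (Fin d) (Fin d) ℝ) + (q + y + z)) k) p - gradCov (𝒞 ((1 : Matrix (Fin d) (Fin d) ℝ) + (q + y)) k) p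
          - gradCov (𝒞 ((1 : Matrix (Fin d) (Fin d) ℝ) + (q + z)) k) p + gradCov (𝒞 ((1 : Matrix (Fin d) (Fin d) ℝ) + q) k) p| ≤
      4 * ((d : ℝ) ^ 4 * secondDiffConst (fun α => Cα α 2)) * (∑ i, ∑ j, |y i j|) * (∑ i, ∑ j, |z i j|) := by
  have hL0 : (0 : ℝ) < L := by exact_mod_cast (show 0 < L by omega)
  have hLpow : 0 < (L : ℝ) ^ ((k - 1) * d) := pow_pos hL0 _
  have hS0 : 0 ≤ secondDiffConst (fun α => Cα α 2) := secondDiffConst_nonneg _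
  -- the scaled function on the sup-normed space
  set s : Set (Fin d → Fin d → ℝ) := {m | (Matrix.of m).IsSymm ∧ ∑ i, ∑ j, |m i j| ≤ T₀} with hs
  have hsc : Convex ℝ s := convex_symmBall T₀
  set f : (Fin d → Fin d → ℝ) → ℝ := fun m =>
    (L : ℝ) ^ ((k - 1) * d) * gradCov (𝒞 ((1 : Matrix (Fin d) (Fin d) ℝ) + Matrix.of m) k) p with hf
  set Mc : ℝ := (d : ℝ) ^ 4 * secondDiffConst (fun α => Cα α 2) with hMc
  have hMc0 : 0 ≤ Mc := by positivity
  -- the line hypothesis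
  have hline : ∀ x h : Fin d → Fin d → ℝ, x ∈ s → x + h ∈ s → x + (2 : ℝ) • h ∈ s →
      ‖f (x + (2 : ℝ) • h) - (2 : ℝ) • f (x + h) + f x‖ ≤ Mc * ‖h‖ ^ 2 := by
    intro x h hx hxh hx2h
    have hhsymm : (Matrix.of h).IsSymm := by
      have : Matrix.of h = Matrix.of (x + h) - Matrix.of x := by simp
      rw [this]; exact hxh.1.sub hx.1
    set T := ∑ i, ∑ j, |h i j| with hTdef
    have hT0 : 0 ≤ T := sum_nonneg fun _ _ => sum_nonneg fun _ _ => abs_nonneg _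
    rcases hT0.eq_or_lt with hTz | hTpos
    · -- `h = 0`
      have hh0 : h = 0 := by
        funext i j
        have hle : |h i j| ≤ T :=
          (single_le_sum (f := fun j => |h i j|) (fun _ _ => abs_nonneg _) (mem_univ j)).trans
            (single_le_sum (f := fun i => ∑ j, |h i j|) (fun _ _ => sum_nonneg fun _ _ => abs_nonneg _) (mem_univ i))
        have : |h i j| = 0 := le_antisymm (hTz ▸ hle) (abs_nonneg _)
        simpa using this
      subst hh0
      simp only [smul_zero, add_zero, norm_zero]
      have : f x - (2 : ℝ) • f x + f x = 0 := by rw [smul_eq_mul]; ring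
      rw [this, norm_zero]
      positivity
    · -- a genuine direction: `B = T⁻¹ h` unit symmetric, segment `1 + x + s B`, `s ∈ [0, 2T]`
      set B : Matrix (Fin d) (Fin d) ℝ := T⁻¹ • Matrix.of h with hBdef
      have hBu : IsUnitSymm B := isUnitSymm_inv_smul hhsymm hTpos le_rfl
      have hx2 : ∑ i, ∑ j, |x i j| ≤ 1 / 2 := hx.2.trans hT₀
      have hx2h2 : ∑ i, ∑ j, |(x + (2 : ℝ) • h) i j| ≤ 1 / 2 := hx2h.2.trans hT₀
      -- the segment from `1 + x` to `1 + (x + 2h)` is elliptic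
      have hseg := isElliptic_segment_of_entrySum_le (m := Matrix.of x) (m' := Matrix.of (x + (2 : ℝ) • h))
        hx.1 hx2h.1 hx2 hx2h2 (T := 2 * T) (by linarith)
      have hdir : (2 * T)⁻¹ • (Matrix.of (x + (2 : ℝ) • h) - Matrix.of x) = B := by
        have : Matrix.of (x + (2 : ℝ) • h) - Matrix.of x = (2 : ℝ) • Matrix.of h := by
          ext i j; simp [Matrix.sub_apply, Matrix.of_apply, two_mul]
        rw [this, smul_smul, hBdef]
        congr 1
        field_simp
      rw [hdir] at hseg
      have hell : ∀ s' ∈ Icc 0 (2 * T), IsElliptic (1 / 2 : ℝ) 2 ((1 : Matrix (Fin d) (Fin d) ℝ) + Matrix.of x + s' • B) :=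
        hseg
      have hmain := abs_gradCov_line_secondDiff_le_of_torusFRD hiv hd hn hL hBu hT0 hell hk1 hkN p
      -- identify the three points
      have hTB : T • B = Matrix.of h := by rw [hBdef, smul_smul, mul_inv_cancel₀ hTpos.ne', one_smul]
      have h2TB : (2 * T) • B = Matrix.of ((2 : ℝ) • h) := by
        rw [mul_smul, hTB]; rfl
      have e1 : (1 : Matrix (Fin d) (Fin d) ℝ) + Matrix.of x + (2 * T) • B = 1 + Matrix.of (x + (2 : ℝ) • h) := by
        rw [h2TB, add_assoc]; rfl
      have e2 : (1 : Matrix (Fin d) (Fin d) ℝ) + Matrix.of x + T • B = 1 + Matrix.of (x + h) := by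
        rw [hTB, add_assoc]; rfl
      rw [e1, e2] at hmain
      -- `T ≤ d² ‖h‖`
      have hTn : T ≤ (d : ℝ) ^ 2 * ‖h‖ := entrySum_le_sq_mul_norm h
      have hf2 : f (x + (2 : ℝ) • h) - (2 : ℝ) • f (x + h) + f x =
          (L : ℝ) ^ ((k - 1) * d) * (gradCov (𝒞 ((1 : Matrix (Fin d) (Fin d) ℝ) + Matrix.of (x + (2 : ℝ) • h)) k) p -
            2 * gradCov (𝒞 ((1 : Matrix (Fin d) (Fin d) ℝ) + Matrix.of (x + h)) k) p +
              gradCov (𝒞 ((1 : Matrix (Fin d) (Fin d) ℝ) + Matrix.of x) k) p) := by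
        simp only [hf, smul_eq_mul]; ring
      rw [hf2, Real.norm_eq_abs, abs_mul, abs_of_pos hLpow]
      calc (L : ℝ) ^ ((k - 1) * d) * |gradCov (𝒞 (1 + Matrix.of (x + (2 : ℝ) • h)) k) p -
            2 * gradCov (𝒞 (1 + Matrix.of (x + h)) k) p + gradCov (𝒞 (1 + Matrix.of x) k) p|
          ≤ secondDiffConst (fun α => Cα α 2) * T ^ 2 := hmain
        _ ≤ secondDiffConst (fun α => Cα α 2) * ((d : ℝ) ^ 2 * ‖h‖) ^ 2 :=
            mul_le_mul_of_nonneg_left (pow_le_pow_left₀ hT0 hTn 2) hS0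
        _ = Mc * ‖h‖ ^ 2 := by rw [hMc]; ring
  -- apply the bilinear lemma
  have hq' : (q : Fin d → Fin d → ℝ) ∈ s := hq
  have hqy' : (q : Fin d → Fin d → ℝ) + y ∈ s := hqy
  have hqz' : (q : Fin d → Fin d → ℝ) + z ∈ s := hqz
  have hqyz' : (q : Fin d → Fin d → ℝ) + y + z ∈ s := hqyz
  have hbil := norm_secondDiff_le_bilinear hsc hMc0 hline hq' hqy' hqz' hqyz'
  have hfval : ∀ m : Fin d → Fin d → ℝ,
      f m = (L : ℝ) ^ ((k - 1) * d) * gradCov (𝒞 ((1 : Matrix (Fin d) (Fin d) ℝ) + Matrix.of m) k) p :=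
    fun m => rfl
  rw [hfval, hfval, hfval, hfval] at hbil
  have e : ∀ A B C D : ℝ, ‖(L : ℝ) ^ ((k - 1) * d) * A - (L : ℝ) ^ ((k - 1) * d) * B - (L : ℝ) ^ ((k - 1) * d) * C +
      (L : ℝ) ^ ((k - 1) * d) * D‖ = (L : ℝ) ^ ((k - 1) * d) * |A - B - C + D| := by
    intro A B C D
    rw [Real.norm_eq_abs, ← abs_of_pos hLpow, ← abs_mul, abs_of_pos hLpow]
    congr 1; ring
  rw [e] at hbil
  refine le_trans (le_of_eq rfl) (hbil.trans ?_)
  have hy : ‖Matrix.of.symm y‖ ≤ ∑ i, ∑ j, |y i j| := norm_le_entrySum _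
  have hz : ‖Matrix.of.symm z‖ ≤ ∑ i, ∑ j, |z i j| := norm_le_entrySum _
  have hMc4 : 0 ≤ 4 * Mc := by positivity
  exact mul_le_mul (mul_le_mul_of_nonneg_left hy hMc4) hz (norm_nonneg _) (mul_nonneg hMc4 (entrySum_nonneg y))

/-! ## The q-slot F4a2 -/

/-- **Parallelogram second differences of `(A^{(q)}_k)⁻¹` in the tuning parameter** (family F4a2): for one
`TorusFRD` package (clause (iv)), symmetric `q, q+y, q+z, q+y+z` in the ball `Σ|·| ≤ T₀ ≤ ½`, `k + 1 ≤ N + 1`: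
`‖Σ± (rgA L h 𝒞s_{q••} k)⁻¹ w‖ ≤ (d⁴·secondDiffConst(C_{·,2}) / h²) · Σ|y| · Σ|z| · ‖w‖` — no dependence on `N`.
[cite: AdamsBuchholzKoteckyMuller2019, Lemma 12.6 (12.51)] -/
theorem norm_rgA_symm_secondDiff_le_of_torusFRD {L N n : ℕ} {h : ℝ} [Fact (0 < h)] [Fact (0 < L)]
    {𝒞 : Matrix (Fin d) (Fin d) ℝ → ℕ → (Fin d → ZMod M) → ℝ} {Cα : (Fin d → ℕ) → ℕ → ℝ}
    (hiv : ∀ A : Matrix (Fin d) (Fin d) ℝ, IsElliptic (1 / 2 : ℝ) 2 A →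
      ∀ k, 1 ≤ k → k ≤ N + 1 → ∀ B : Matrix (Fin d) (Fin d) ℝ, IsUnitSymm B →
        (∃ ε : ℝ, 0 < ε ∧ ∀ x : Fin d → ZMod M,
          ContDiffOn ℝ ⊤ (fun s : ℝ => 𝒞 (A + s • B) k x) (Set.Ioo (-ε) ε)) ∧
        ∀ α : Fin d → ℕ, ∑ i, α i ≤ n → ∀ ℓ : ℕ, ∀ x : Fin d → ZMod M,
          abs (iteratedDeriv ℓ (fun s : ℝ => iterDiff α (𝒞 (A + s • B) k) x) 0)
            ≤ Cα α ℓ / (L : ℝ) ^ ((k - 1) * (d - 2 + ∑ i, α i)))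
    (hd : 2 ≤ d) (hn : 2 ≤ n) {T₀ : ℝ} (hT₀ : T₀ ≤ 1 / 2)
    {q y z : Matrix (Fin d) (Fin d) ℝ}
    (hq : q.IsSymm ∧ ∑ i, ∑ j, |q i j| ≤ T₀) (hqy : (q + y).IsSymm ∧ ∑ i, ∑ j, |(q + y) i j| ≤ T₀)
    (hqz : (q + z).IsSymm ∧ ∑ i, ∑ j, |(q + z) i j| ≤ T₀)
    (hqyz : (q + y + z).IsSymm ∧ ∑ i, ∑ j, |(q + y + z) i j| ≤ T₀)
    {k : ℕ} (hkN : k + 1 ≤ N + 1)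
    (w : HamSpace ℂ d (fieldWt h (L : ℝ) d (k + 1)) ((L : ℝ) ^ (k + 1)) (L ^ (d * (k + 1)))) :
    ‖(rgA L h (fun j => 𝒞 ((1 : Matrix (Fin d) (Fin d) ℝ) + (q + y + z)) j) k).symm w -
        (rgA L h (fun j => 𝒞 ((1 : Matrix (Fin d) (Fin d) ℝ) + (q + y)) j) k).symm w -
        (rgA L h (fun j => 𝒞 ((1 : Matrix (Fin d) (Fin d) ℝ) + (q + z)) j) k).symm w +
        (rgA L h (fun j => 𝒞 ((1 : Matrix (Fin d) (Fin d) ℝ) + q) j) k).symm w‖ ≤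
      ((d : ℝ) ^ 4 * secondDiffConst (fun α => Cα α 2) / h ^ 2) * (∑ i, ∑ j, |y i j|) * (∑ i, ∑ j, |z i j|) * ‖w‖ := by
  have hh : 0 < h := Fact.out
  have hL : 0 < L := Fact.out
  have hL1 : 1 ≤ L := hL
  set Ty := ∑ i, ∑ j, |y i j| with hTy
  set Tz := ∑ i, ∑ j, |z i j| with hTz
  have hTy0 : 0 ≤ Ty := entrySum_nonneg _
  have hTz0 : 0 ≤ Tz := entrySum_nonneg _
  have hS0 : 0 ≤ secondDiffConst (fun α => Cα α 2) := secondDiffConst_nonneg _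
  -- the second difference of `γ`
  set γ₁₁ := gradCov (𝒞 ((1 : Matrix (Fin d) (Fin d) ℝ) + (q + y + z)) (k + 1)) with hγ₁₁
  set γ₁₀ := gradCov (𝒞 ((1 : Matrix (Fin d) (Fin d) ℝ) + (q + y)) (k + 1)) with hγ₁₀
  set γ₀₁ := gradCov (𝒞 ((1 : Matrix (Fin d) (Fin d) ℝ) + (q + z)) (k + 1)) with hγ₀₁
  set γ₀₀ := gradCov (𝒞 ((1 : Matrix (Fin d) (Fin d) ℝ) + q) (k + 1)) with hγ₀₀
  have hγ : ∀ pq : quadIndex d, ((L ^ (d * k) : ℕ) : ℝ) * |(γ₁₁ - γ₁₀ - γ₀₁ + γ₀₀) pq - (0 : quadIndex d → ℝ) pq| ≤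
      4 * ((d : ℝ) ^ 4 * secondDiffConst (fun α => Cα α 2)) * Ty * Tz := by
    intro pq
    have h1 := abs_gradCov_secondDiff_le_of_torusFRD hiv hd hn hL1 hT₀ (k := k + 1) (by omega) hkN pq hq hqy hqz hqyz
    have e : ((L ^ (d * k) : ℕ) : ℝ) = (L : ℝ) ^ ((k + 1 - 1) * d) := by
      rw [Nat.add_sub_cancel, Nat.cast_pow, mul_comm]
    rw [e]
    simpa only [Pi.add_apply, Pi.sub_apply, Pi.zero_apply, sub_zero] using h1
  -- the case `y = 0` or `z = 0` (then `δ = 0`) is covered by a limiting `δ > 0`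
  rw [HamSpace.norm_def, HamSpace.norm_def, map_add, map_sub, map_sub]
  unfold rgA
  rw [toHam_stepOpAEquiv_symm, toHam_stepOpAEquiv_symm, toHam_stepOpAEquiv_symm, toHam_stepOpAEquiv_symm,
    stepOpAInv_secondDiff_eq]
  set δ₀ := 4 * ((d : ℝ) ^ 4 * secondDiffConst (fun α => Cα α 2)) * Ty * Tz with hδ₀
  have hδ₀0 : 0 ≤ δ₀ := by positivity
  -- use `δ = δ₀ + ε` for every `ε > 0` and let `ε → 0`
  set W := hamNorm (fieldWt h (L : ℝ) d (k + 1)) ((L : ℝ) ^ (k + 1)) (L ^ (d * (k + 1))) (HamSpace.toHam w) with hW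
  have hW0 : 0 ≤ W := hamNorm_nonneg (fieldWt_pos hh (by exact_mod_cast hL) d (k + 1)).le (by positivity) _ _
  have h4 : (0 : ℝ) < 4 * h ^ 2 := by positivity
  have hmain : ∀ ε : ℝ, 0 < ε →
      hamNorm (fieldWt h (L : ℝ) d k) ((L : ℝ) ^ k) (L ^ (d * k))
          (stepOpAInv (γ₁₁ - γ₁₀ - γ₀₁ + γ₀₀) (HamSpace.toHam w) - stepOpAInv 0 (HamSpace.toHam w)) ≤
        ((δ₀ + ε) / (4 * h ^ 2)) * W := by
    intro ε hε
    exact hamNorm_stepOpAInv_sub_abkm_le hd hL1 hh (by linarith) k (fun pq => (hγ pq).trans (by linarith)) _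
  have hlim : hamNorm (fieldWt h (L : ℝ) d k) ((L : ℝ) ^ k) (L ^ (d * k))
        (stepOpAInv (γ₁₁ - γ₁₀ - γ₀₁ + γ₀₀) (HamSpace.toHam w) - stepOpAInv 0 (HamSpace.toHam w)) ≤
      (δ₀ / (4 * h ^ 2)) * W := by
    refine le_of_forall_pos_lt_add fun ε hε => ?_
    have hpos : 0 < W + 1 := by linarith
    have hne : W + 1 ≠ 0 := hpos.ne'
    have h1 := hmain (ε * (4 * h ^ 2) / (W + 1)) (div_pos (mul_pos hε h4) hpos)
    refine h1.trans_lt ?_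
    have e : (δ₀ + ε * (4 * h ^ 2) / (W + 1)) / (4 * h ^ 2) * W = δ₀ / (4 * h ^ 2) * W + ε * W / (W + 1) := by
      field_simp
    rw [e]
    have : ε * W / (W + 1) < ε := by
      rw [div_lt_iff₀ hpos]; nlinarith
    linarith
  refine hlim.trans (le_of_eq ?_)
  rw [hδ₀]
  ring

end Literature.MathematicalPhysics.StatisticalMechanics.GradientRG

end
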